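import Mathlib
import Summits.ValiantsHypothesis.ValiantsHypothesis.Theorems.RigidityForcesSymmetryRankRigidMinimalReprLaplaceFourDefs
import Summits.ValiantsHypothesis.ValiantsHypothesis.Theorems.RigidityForcesSymmetryRankRigidMinimalReprLaplaceFourContraction
import Summits.ValiantsHypothesis.ValiantsHypothesis.Theorems.RigidityForcesSymmetryRankRigidMinimalReprLaplaceFourLineCore

/-!
# LINE profiles of `LaplaceOptimal 4`, stage B: the star and the matching kill affine columns
# (crux `RankRigidMinimalRepr`, stmt-ValiantsHypothesis-18034, route `RigidityForcesSymmetry`)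

After stage A (`line_core`, `…LaplaceFourLineCore.lean`) and the letter relabelling, a LINE profile satisfies, for every
`φ` in the torus, `Q(ℓφ, φ) = x₁(φ) y₁(φ)ᵀ + x₂(φ) y₂(φ)ᵀ` where `ℓφ` is the star `(φ₀,-φ₁,-φ₂,-φ₃)` or the matching
`(φ₀,-φ₁,0,0)` and the columns `x_t(φ)` come from the two rank-one terms.  The left-hand sides are explicit:
`e₀rᵀ + re₀ᵀ` with `r = -2(0, φ₂φ₃, φ₁φ₃, φ₁φ₂)` for the star (`contract_star`), `uwᵀ + wuᵀ` with
`u = (-φ₁, φ₀, 0, 0)`, `w = (0, 0, φ₃, φ₂)` for the matching (`contract_matching`).  A vector `n` annihilating the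
left-hand side annihilates both columns (`two_rank_one_cols`, using a non-zero `2 × 2` minor); with `n = (0,φ₁,-φ₂,0)`,
`(0,0,φ₂,-φ₃)` this yields quadratic identities on the torus whose coefficients are extracted by evaluation at nine
torus points (`quad_identity_12`, `quad_identity_23`).  Consequences:

* `star_kill` — if both columns are AFFINE in `φ`, the star identity is impossible (kills type (a) for all five LINE
  profiles: columns `B(ℓφ)`, `C′φ` or a fixed `f`);
* `matching_kill` — if both columns are affine in `φ₀, φ₁` only, the matching identity is impossible (profiles
  `(3,2,0)`, `slice+(2,2,0)`, `slice+(3,1,0)`).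

HONEST FRAMING: finite algebra toward `LaplaceOptimal 4` (rung `TiedTorusBound 3`); the crux stays OPEN; nothing here
bears on `VP ≠ VNP`.
-/

set_option autoImplicit false

-- the mandated summit-side namespace repeats a component by design (single-problem summit)
set_option linter.dupNamespace false

namespace Summit.ValiantsHypothesis.ValiantsHypothesis.Theorems.RigidityForcesSymmetryRankRigidMinimalRepr

namespace LaplaceFourLine

open Matrix LaplaceFourContraction

/-! ### §1 Two rank-one products: a left annihilator kills both columns -/

/-- If `M = x₁y₁ᵀ + x₂y₂ᵀ` has a non-zero `2 × 2` minor and `nᵀM = 0`, then `n·x₁ = n·x₂ = 0`. -/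
theorem two_rank_one_cols (x₁ y₁ x₂ y₂ n : Fin 4 → ℂ) (M : Matrix (Fin 4) (Fin 4) ℂ)
    (hM : M = vecMulVec x₁ y₁ + vecMulVec x₂ y₂) (hn : ∀ w, ∑ z, n z * M z w = 0)
    {z z' w w' : Fin 4} (hminor : M z w * M z' w' - M z w' * M z' w ≠ 0) :
    (∑ z, n z * x₁ z) = 0 ∧ (∑ z, n z * x₂ z) = 0 := by
  set α := ∑ z, n z * x₁ z with hα
  set β := ∑ z, n z * x₂ z with hβ
  have hM' : ∀ i j, M i j = x₁ i * y₁ j + x₂ i * y₂ j := fun i j => by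
    rw [hM]; simp [vecMulVec_apply]
  have hrel : ∀ w, α * y₁ w + β * y₂ w = 0 := fun w => by
    have := hn w
    simp_rw [hM'] at this
    rw [hα, hβ, Finset.sum_mul, Finset.sum_mul, ← Finset.sum_add_distrib, ← this]
    exact Finset.sum_congr rfl fun z _ => by ring
  by_contra hne
  rw [not_and_or] at hne
  apply hminor
  rcases hne with ha | hb
  · -- `y₁ = -(β/α) y₂`, so `M = (x₂ - (β/α)x₁) y₂ᵀ` has vanishing minors
    have hy : ∀ w, y₁ w = -(β / α) * y₂ w := fun w => by
      field_simp; linear_combination hrel w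
    simp only [hM', hy]; ring
  · have hy : ∀ w, y₂ w = -(α / β) * y₁ w := fun w => by
      field_simp; linear_combination hrel w
    simp only [hM', hy]; ring

/-! ### §2 The two canonical families: explicit left-hand sides -/

/-- The star at `0`: `lineVec (inl 0) φ = (φ₀, -φ₁, -φ₂, -φ₃)`. -/
theorem lineVec_star (φ : Fin 4 → ℂ) : lineVec (Sum.inl 0) φ = ![φ 0, -φ 1, -φ 2, -φ 3] := by
  funext k; fin_cases k <;> simp [lineVec]

/-- The matching `(0,1)`: `lineVec (inr (0,1)) φ = (φ₀, -φ₁, 0, 0)`. -/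
theorem lineVec_matching (φ : Fin 4 → ℂ) : lineVec (Sum.inr (0, 1)) φ = ![φ 0, -φ 1, 0, 0] := by
  funext k; fin_cases k <;> simp [lineVec]

/-- `Q((φ₀,-φ₁,-φ₂,-φ₃), φ) = e₀ rᵀ + r e₀ᵀ`, `r = -2(0, φ₂φ₃, φ₁φ₃, φ₁φ₂)`. -/
theorem contract_star (φ : Fin 4 → ℂ) : contract₀₁ permPattern₄ (lineVec (Sum.inl 0) φ) φ =
    !![0, -(2 * φ 2 * φ 3), -(2 * φ 1 * φ 3), -(2 * φ 1 * φ 2);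
      -(2 * φ 2 * φ 3), 0, 0, 0; -(2 * φ 1 * φ 3), 0, 0, 0; -(2 * φ 1 * φ 2), 0, 0, 0] := by
  rw [lineVec_star, contract_permPattern_entries]
  ext i j; fin_cases i <;> fin_cases j <;> simp <;> ring

/-- `Q((φ₀,-φ₁,0,0), φ) = u wᵀ + w uᵀ`, `u = (-φ₁, φ₀, 0, 0)`, `w = (0, 0, φ₃, φ₂)`. -/
theorem contract_matching (φ : Fin 4 → ℂ) : contract₀₁ permPattern₄ (lineVec (Sum.inr (0, 1)) φ) φ =
    !![0, 0, -(φ 1 * φ 3), -(φ 1 * φ 2); 0, 0, φ 0 * φ 3, φ 0 * φ 2;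
      -(φ 1 * φ 3), φ 0 * φ 3, 0, 0; -(φ 1 * φ 2), φ 0 * φ 2, 0, 0] := by
  rw [lineVec_matching, contract_permPattern_entries]
  ext i j; fin_cases i <;> fin_cases j <;> simp <;> ring

/-! ### §3 Coefficient extraction on the torus -/

/-- Coefficient extraction: if `φ_1·L_1(φ) = φ_2·L_2(φ)` on the torus for affine forms `L_k(φ) = c_k + Σ_x a_xk φ_x`,
then the listed coefficients vanish (evaluation at nine torus points and a Vandermonde-type inversion). -/
theorem quad_identity_12 (c : Fin 4 → ℂ) (a : Fin 4 → Fin 4 → ℂ)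
    (h : ∀ φ : Fin 4 → ℂ, (∀ i, φ i ≠ 0) →
      φ 1 * (c 1 + ∑ x, a x 1 * φ x) = φ 2 * (c 2 + ∑ x, a x 2 * φ x)) :
    c 1 = 0 ∧ a 0 1 = 0 ∧ a 1 1 = 0 ∧ a 2 1 = a 1 2 ∧ a 3 1 = 0 ∧ c 2 = 0 ∧ a 0 2 = 0 ∧ a 2 2 = 0 ∧ a 3 2 = 0 := by
  have e1111 := h ![(1 : ℂ), (1 : ℂ), (1 : ℂ), (1 : ℂ)] (by intro i; fin_cases i <;> norm_num)
  have e1112 := h ![(1 : ℂ), (1 : ℂ), (1 : ℂ), (2 : ℂ)] (by intro i; fin_cases i <;> norm_num)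
  have e1121 := h ![(1 : ℂ), (1 : ℂ), (2 : ℂ), (1 : ℂ)] (by intro i; fin_cases i <;> norm_num)
  have e1122 := h ![(1 : ℂ), (1 : ℂ), (2 : ℂ), (2 : ℂ)] (by intro i; fin_cases i <;> norm_num)
  have e1131 := h ![(1 : ℂ), (1 : ℂ), (3 : ℂ), (1 : ℂ)] (by intro i; fin_cases i <;> norm_num)
  have e1211 := h ![(1 : ℂ), (2 : ℂ), (1 : ℂ), (1 : ℂ)] (by intro i; fin_cases i <;> norm_num)
  have e1221 := h ![(1 : ℂ), (2 : ℂ), (2 : ℂ), (1 : ℂ)] (by intro i; fin_cases i <;> norm_num)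
  have e2111 := h ![(2 : ℂ), (1 : ℂ), (1 : ℂ), (1 : ℂ)] (by intro i; fin_cases i <;> norm_num)
  have e2121 := h ![(2 : ℂ), (1 : ℂ), (2 : ℂ), (1 : ℂ)] (by intro i; fin_cases i <;> norm_num)
  simp only [Fin.sum_univ_four, Matrix.cons_val_zero, Matrix.cons_val_one, Matrix.head_cons, Matrix.cons_val_two,
    Matrix.tail_cons, Matrix.cons_val_three] at e1111 e1112 e1121 e1122 e1131 e1211 e1221 e2111 e2121
  refine ⟨?_, ?_, ?_, ?_, ?_, ?_, ?_, ?_, ?_⟩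
  · linear_combination ((19 : ℂ)/2) * e1111 + (-2 : ℂ) * e1112 + (-7 : ℂ) * e1121 +
      (1 : ℂ) * e1122 + ((3 : ℂ)/2) * e1131 + (-1 : ℂ) * e1211 + ((1 : ℂ)/2) * e1221 +
      (-2 : ℂ) * e2111 + (1 : ℂ) * e2121
  · linear_combination (-2 : ℂ) * e1111 + (1 : ℂ) * e1121 + (2 : ℂ) * e2111 + (-1 : ℂ) * e2121
  · linear_combination ((-5 : ℂ)/2) * e1111 + (2 : ℂ) * e1121 + ((-1 : ℂ)/2) * e1131 +
      (1 : ℂ) * e1211 + ((-1 : ℂ)/2) * e1221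
  · linear_combination (1 : ℂ) * e1111 + (-1 : ℂ) * e1121 + (-1 : ℂ) * e1211 + (1 : ℂ) * e1221
  · linear_combination (-2 : ℂ) * e1111 + (2 : ℂ) * e1112 + (1 : ℂ) * e1121 + (-1 : ℂ) * e1122
  · linear_combination ((11 : ℂ)/2) * e1111 + (-1 : ℂ) * e1112 + (-7 : ℂ) * e1121 +
      (1 : ℂ) * e1122 + ((3 : ℂ)/2) * e1131 + (-1 : ℂ) * e1211 + (1 : ℂ) * e1221 +
      (-1 : ℂ) * e2111 + (1 : ℂ) * e2121
  · linear_combination (-1 : ℂ) * e1111 + (1 : ℂ) * e1121 + (1 : ℂ) * e2111 + (-1 : ℂ) * e2121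
  · linear_combination ((-1 : ℂ)/2) * e1111 + (1 : ℂ) * e1121 + ((-1 : ℂ)/2) * e1131
  · linear_combination (-1 : ℂ) * e1111 + (1 : ℂ) * e1112 + (1 : ℂ) * e1121 + (-1 : ℂ) * e1122

/-- Coefficient extraction: if `φ_2·L_2(φ) = φ_3·L_3(φ)` on the torus for affine forms `L_k(φ) = c_k + Σ_x a_xk φ_x`,
then the listed coefficients vanish (evaluation at nine torus points and a Vandermonde-type inversion). -/
theorem quad_identity_23 (c : Fin 4 → ℂ) (a : Fin 4 → Fin 4 → ℂ)
    (h : ∀ φ : Fin 4 → ℂ, (∀ i, φ i ≠ 0) →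
      φ 2 * (c 2 + ∑ x, a x 2 * φ x) = φ 3 * (c 3 + ∑ x, a x 3 * φ x)) :
    c 2 = 0 ∧ a 0 2 = 0 ∧ a 1 2 = 0 ∧ a 2 2 = 0 ∧ a 3 2 = a 2 3 ∧ c 3 = 0 ∧ a 0 3 = 0 ∧ a 1 3 = 0 ∧ a 3 3 = 0 := by
  have e1111 := h ![(1 : ℂ), (1 : ℂ), (1 : ℂ), (1 : ℂ)] (by intro i; fin_cases i <;> norm_num)
  have e1112 := h ![(1 : ℂ), (1 : ℂ), (1 : ℂ), (2 : ℂ)] (by intro i; fin_cases i <;> norm_num)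
  have e1113 := h ![(1 : ℂ), (1 : ℂ), (1 : ℂ), (3 : ℂ)] (by intro i; fin_cases i <;> norm_num)
  have e1121 := h ![(1 : ℂ), (1 : ℂ), (2 : ℂ), (1 : ℂ)] (by intro i; fin_cases i <;> norm_num)
  have e1122 := h ![(1 : ℂ), (1 : ℂ), (2 : ℂ), (2 : ℂ)] (by intro i; fin_cases i <;> norm_num)
  have e1211 := h ![(1 : ℂ), (2 : ℂ), (1 : ℂ), (1 : ℂ)] (by intro i; fin_cases i <;> norm_num)
  have e1212 := h ![(1 : ℂ), (2 : ℂ), (1 : ℂ), (2 : ℂ)] (by intro i; fin_cases i <;> norm_num)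
  have e2111 := h ![(2 : ℂ), (1 : ℂ), (1 : ℂ), (1 : ℂ)] (by intro i; fin_cases i <;> norm_num)
  have e2112 := h ![(2 : ℂ), (1 : ℂ), (1 : ℂ), (2 : ℂ)] (by intro i; fin_cases i <;> norm_num)
  simp only [Fin.sum_univ_four, Matrix.cons_val_zero, Matrix.cons_val_one, Matrix.head_cons, Matrix.cons_val_two,
    Matrix.tail_cons, Matrix.cons_val_three] at e1111 e1112 e1113 e1121 e1122 e1211 e1212 e2111 e2112
  refine ⟨?_, ?_, ?_, ?_, ?_, ?_, ?_, ?_, ?_⟩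
  · linear_combination ((19 : ℂ)/2) * e1111 + (-7 : ℂ) * e1112 + ((3 : ℂ)/2) * e1113 +
      (-1 : ℂ) * e1121 + ((1 : ℂ)/2) * e1122 + (-2 : ℂ) * e1211 + (1 : ℂ) * e1212 +
      (-2 : ℂ) * e2111 + (1 : ℂ) * e2112
  · linear_combination (-2 : ℂ) * e1111 + (1 : ℂ) * e1112 + (2 : ℂ) * e2111 + (-1 : ℂ) * e2112
  · linear_combination (-2 : ℂ) * e1111 + (1 : ℂ) * e1112 + (2 : ℂ) * e1211 + (-1 : ℂ) * e1212
  · linear_combination ((-5 : ℂ)/2) * e1111 + (2 : ℂ) * e1112 + ((-1 : ℂ)/2) * e1113 +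
      (1 : ℂ) * e1121 + ((-1 : ℂ)/2) * e1122
  · linear_combination (1 : ℂ) * e1111 + (-1 : ℂ) * e1112 + (-1 : ℂ) * e1121 + (1 : ℂ) * e1122
  · linear_combination ((11 : ℂ)/2) * e1111 + (-7 : ℂ) * e1112 + ((3 : ℂ)/2) * e1113 +
      (-1 : ℂ) * e1121 + (1 : ℂ) * e1122 + (-1 : ℂ) * e1211 + (1 : ℂ) * e1212 + (-1 : ℂ) * e2111 +
      (1 : ℂ) * e2112
  · linear_combination (-1 : ℂ) * e1111 + (1 : ℂ) * e1112 + (1 : ℂ) * e2111 + (-1 : ℂ) * e2112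
  · linear_combination (-1 : ℂ) * e1111 + (1 : ℂ) * e1112 + (1 : ℂ) * e1211 + (-1 : ℂ) * e1212
  · linear_combination ((-1 : ℂ)/2) * e1111 + (1 : ℂ) * e1112 + ((-1 : ℂ)/2) * e1113

/-! ### §4 The two kills -/

/-- **The star kills affine columns.**  If, for every `φ` in the torus, `Q((φ₀,-φ₁,-φ₂,-φ₃), φ)` is a sum of two
rank-one products whose COLUMNS are affine functions of `φ`, we reach a contradiction. -/
theorem star_kill (x₁ x₂ y₁ y₂ : (Fin 4 → ℂ) → (Fin 4 → ℂ)) (c₁ c₂ : Fin 4 → ℂ) (A₁ A₂ : Fin 4 → Fin 4 → ℂ)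
    (hx₁ : ∀ φ k, x₁ φ k = c₁ k + ∑ x, A₁ x k * φ x) (hx₂ : ∀ φ k, x₂ φ k = c₂ k + ∑ x, A₂ x k * φ x)
    (h : ∀ φ : Fin 4 → ℂ, (∀ i, φ i ≠ 0) → contract₀₁ permPattern₄ (lineVec (Sum.inl 0) φ) φ =
      vecMulVec (x₁ φ) (y₁ φ) + vecMulVec (x₂ φ) (y₂ φ)) : False := by
  -- the two annihilators of `e₀ rᵀ + r e₀ᵀ`
  have hcols : ∀ φ : Fin 4 → ℂ, (∀ i, φ i ≠ 0) →
      (φ 1 * x₁ φ 1 = φ 2 * x₁ φ 2 ∧ φ 1 * x₂ φ 1 = φ 2 * x₂ φ 2) ∧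
      (φ 2 * x₁ φ 2 = φ 3 * x₁ φ 3 ∧ φ 2 * x₂ φ 2 = φ 3 * x₂ φ 3) := by
    intro φ hφ
    have hM := h φ hφ
    have hE := contract_star φ
    set M := contract₀₁ permPattern₄ (lineVec (Sum.inl 0) φ) φ with hMdef
    have hminor : M 0 1 * M 1 0 - M 0 0 * M 1 1 ≠ 0 := by
      have : M 0 1 * M 1 0 - M 0 0 * M 1 1 = (2 * φ 2 * φ 3) ^ 2 := by rw [hE]; simp; ring
      rw [this]; exact pow_ne_zero 2 (mul_ne_zero (mul_ne_zero two_ne_zero (hφ 2)) (hφ 3))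
    have h1 := two_rank_one_cols _ _ _ _ ![0, φ 1, -φ 2, 0] M hM (fun w => by
      rw [hE]; (fin_cases w <;> simp [Fin.sum_univ_four]); ring) hminor
    have h2 := two_rank_one_cols _ _ _ _ ![0, 0, φ 2, -φ 3] M hM (fun w => by
      rw [hE]; (fin_cases w <;> simp [Fin.sum_univ_four]); ring) hminor
    simp [Fin.sum_univ_four] at h1 h2
    refine ⟨⟨by linear_combination h1.1, by linear_combination h1.2⟩,
      ⟨by linear_combination h2.1, by linear_combination h2.2⟩⟩
  -- coefficient extraction: the columns live in `ℂ e₀`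
  have q12₁ := quad_identity_12 c₁ A₁ (fun φ hφ => by
    have := ((hcols φ hφ).1).1; rwa [hx₁, hx₁] at this)
  have q23₁ := quad_identity_23 c₁ A₁ (fun φ hφ => by
    have := ((hcols φ hφ).2).1; rwa [hx₁, hx₁] at this)
  have q12₂ := quad_identity_12 c₂ A₂ (fun φ hφ => by
    have := ((hcols φ hφ).1).2; rwa [hx₂, hx₂] at this)
  have q23₂ := quad_identity_23 c₂ A₂ (fun φ hφ => by
    have := ((hcols φ hφ).2).2; rwa [hx₂, hx₂] at this)
  have hx₁1 : ∀ φ, x₁ φ 1 = 0 := fun φ => by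
    rw [hx₁, Fin.sum_univ_four]
    obtain ⟨c1, a01, a11, a21, a31, -, -, -, -⟩ := q12₁
    obtain ⟨-, -, a12, -, -, -, -, -, -⟩ := q23₁
    rw [c1, a01, a11, a21, a12, a31]; ring
  have hx₂1 : ∀ φ, x₂ φ 1 = 0 := fun φ => by
    rw [hx₂, Fin.sum_univ_four]
    obtain ⟨c1, a01, a11, a21, a31, -, -, -, -⟩ := q12₂
    obtain ⟨-, -, a12, -, -, -, -, -, -⟩ := q23₂
    rw [c1, a01, a11, a21, a12, a31]; ring
  -- entry `(1,0)` at `φ = 𝟙`: `-2 = 0`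
  have h1 := h (fun _ => 1) (fun _ => one_ne_zero)
  have e := congrFun (congrFun h1 1) 0
  rw [contract_star] at e
  simp [vecMulVec_apply, hx₁1, hx₂1] at e

/-- **The matching kills columns depending affinely on `φ₀, φ₁` only.**  If, for every `φ` in the torus,
`Q((φ₀,-φ₁,0,0), φ)` is a sum of two rank-one products whose columns are affine in `φ₀, φ₁` (no `φ₂, φ₃`), contradiction. -/
theorem matching_kill (x₁ x₂ y₁ y₂ : (Fin 4 → ℂ) → (Fin 4 → ℂ)) (c₁ c₂ : Fin 4 → ℂ) (A₁ A₂ : Fin 4 → Fin 4 → ℂ)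
    (hx₁ : ∀ φ k, x₁ φ k = c₁ k + ∑ x, A₁ x k * φ x) (hx₂ : ∀ φ k, x₂ φ k = c₂ k + ∑ x, A₂ x k * φ x)
    (hA₁ : ∀ k, A₁ 2 k = 0 ∧ A₁ 3 k = 0) (hA₂ : ∀ k, A₂ 2 k = 0 ∧ A₂ 3 k = 0)
    (h : ∀ φ : Fin 4 → ℂ, (∀ i, φ i ≠ 0) → contract₀₁ permPattern₄ (lineVec (Sum.inr (0, 1)) φ) φ =
      vecMulVec (x₁ φ) (y₁ φ) + vecMulVec (x₂ φ) (y₂ φ)) : False := by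
  have hcols : ∀ φ : Fin 4 → ℂ, (∀ i, φ i ≠ 0) →
      (φ 2 * x₁ φ 2 = φ 3 * x₁ φ 3 ∧ φ 2 * x₂ φ 2 = φ 3 * x₂ φ 3) := by
    intro φ hφ
    have hM := h φ hφ
    have hE := contract_matching φ
    set M := contract₀₁ permPattern₄ (lineVec (Sum.inr (0, 1)) φ) φ with hMdef
    have hminor : M 0 2 * M 2 0 - M 0 0 * M 2 2 ≠ 0 := by
      have : M 0 2 * M 2 0 - M 0 0 * M 2 2 = (φ 1 * φ 3) ^ 2 := by rw [hE]; simp; ring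
      rw [this]; exact pow_ne_zero 2 (mul_ne_zero (hφ 1) (hφ 3))
    have h2 := two_rank_one_cols _ _ _ _ ![0, 0, φ 2, -φ 3] M hM (fun w => by
      rw [hE]; fin_cases w <;> simp [Fin.sum_univ_four] <;> ring) hminor
    simp [Fin.sum_univ_four] at h2
    exact ⟨by linear_combination h2.1, by linear_combination h2.2⟩
  have q23₁ := quad_identity_23 c₁ A₁ (fun φ hφ => by
    have := (hcols φ hφ).1; rwa [hx₁, hx₁] at this)
  have q23₂ := quad_identity_23 c₂ A₂ (fun φ hφ => by
    have := (hcols φ hφ).2; rwa [hx₂, hx₂] at this)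
  have hx₁2 : ∀ φ, x₁ φ 2 = 0 := fun φ => by
    rw [hx₁, Fin.sum_univ_four]
    obtain ⟨c2, a02, a12, a22, -, -, -, -, -⟩ := q23₁
    rw [c2, a02, a12, a22, (hA₁ 2).2]; ring
  have hx₂2 : ∀ φ, x₂ φ 2 = 0 := fun φ => by
    rw [hx₂, Fin.sum_univ_four]
    obtain ⟨c2, a02, a12, a22, -, -, -, -, -⟩ := q23₂
    rw [c2, a02, a12, a22, (hA₂ 2).2]; ring
  -- entry `(2,0)` at `φ = 𝟙`: `-1 = 0`
  have h1 := h (fun _ => 1) (fun _ => one_ne_zero)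
  have e := congrFun (congrFun h1 2) 0
  rw [contract_matching] at e
  simp [vecMulVec_apply, hx₁2, hx₂2] at e

end LaplaceFourLine

end Summit.ValiantsHypothesis.ValiantsHypothesis.Theorems.RigidityForcesSymmetryRankRigidMinimalRepr
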